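import Literature.AlgebraicGeometry.Motives.AbelianVarietyPermutationPowerIsotypicalMultiplicity
import HarnessLib

/-!
# Permutation powers over a DOUBLY TRANSITIVE `G`-set: `A^S ∼ B_1 × B_θ` with `B_1 ∼ A`, `B_θ ∼ A^{|S| − 1}`, and every
# other isotypical component of `A^S` vanishes

Let `A^S` be a permutation power over a finite, non-trivial, 2-transitive `G`-set `S` (`G` finite; bicone `b`, action `ρ` with
`ι_s ≫ ρ(g) = ι_{g s}`), with isotypical components `B_W = Im u_W` in the vocabulary of
`Motives/AbelianVarietyGroupActionIsotypicalDecomposition` (`|G| e_W = Σ_g c_W(g) g`, `u_W = Σ_g c_W(g) ρ(g)`; hypotheses `hc`, `hu`).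
The permutation character is `π = 1 + θ` with `θ(g) = |S^g| − 1` irreducible (James–Liebeck 29.10), and the isotypical
decomposition of `ℚ[S]` is `1 ⊕ θ` (`RepresentationTheory/FiniteGroups/PermutationModuleIsotypicalMultiplicity` §5:
`dim (e_1 ℂ[S]) = 1`, `dim (e_θ ℂ[S]) = |S| − 1`, `dim (e_W ℂ[S]) = 0` otherwise).  Reading this through
`Motives/AbelianVarietyPermutationPowerIsotypicalMultiplicity` (`dim B_W(A^S) = dim (e_W ℂ[S]) · dim A`, `B_W(A^S) ∼ A^{dim (e_W ℂ[S])}`):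

* (any field) **`dim B_θ(A^S) = (|S| − 1) · dim A`**, `rk Hom(B_θ(A^S), B) = (|S| − 1) · rk Hom(A, B)`, `dim B_1(A^S) = dim A`,
  **`B_W(A^S) = 0`** (`dim = 0`, `rk Hom(B_W, B) = 0`) for every `W ∉ {1, θ}`, and `rk Hom(A^S, B) = rk Hom(B_1, B) + rk Hom(B_θ, B)`;
* (perfect field) **`B_θ(A^S) ∼ A^{|S| − 1}`**, `B_1(A^S) ∼ A`, **`A^S ∼ B_1(A^S) × B_θ(A^S)`** — e.g. `E^n` under `𝔖_n` or `𝔄_n`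
  (`n ≥ 4`), `A^{ℙ¹(𝔽_q)}` under `PGL₂(𝔽_q)`, `A^{𝔽_q^n}` under `AGL_n(𝔽_q)`: the "standard part" `Ker(Σ : A^S → A)⁰ ∼ B_θ` is a
  single isotypical component.

The component of `W` is addressed through a member `e` of the tree's family `ratCharIdempotents G` with `e = e_ℚ(χ)` as a
hypothesis (`he`); everything is a theorem (no definitions).

## References

* [JamesLiebeck2001] G. James, M. Liebeck, *Representations and Characters of Groups*, 2nd ed. (2001), Cor. 29.10
  (`G` is 2-transitive iff `π = 1_G + χ` with `χ` irreducible).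
* [Isaacs1976] I. M. Isaacs, *Character Theory of Finite Groups* (1976), Cor. 5.17.
* [LangeRodriguez2022] H. Lange, R. E. Rodríguez, *Decomposition of Jacobians by Prym Varieties*, LNM 2310 (2022), §2.9.1
  Thm. 2.9.1 and Prop. 2.9.3 (PDF pp. 43, 46).
* [SerreLinearRepresentations1977] J.-P. Serre, *Linear Representations of Finite Groups*, GTM 42 (1977), §2.3 Ex. 2.6, §2.6 Thm. 8.
-/

noncomputable section

open CategoryTheory CategoryTheory.Limits MulAction
open Literature.NumberTheory.DiophantineGeometry
open Literature.RepresentationTheory.FiniteGroups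

universe u

namespace Literature.AlgebraicGeometry.Motives

namespace AbelianVariety

variable {K : Type u} [Field K] {A : AbelianVariety K} {S : Type} [Fintype S] [Nontrivial S] (b : Bicone (fun _ : S ↦ A))
  {G : Type} [Group G] [Fintype G] [MulAction G S] (ρ : G →* End b.pt)
  {c : ratCharIdempotents G → G → ℤ}
  (hc : ∀ e : ratCharIdempotents G,
    (Fintype.card G : ℚ) • (e : MonoidAlgebra ℚ G) = ∑ g, (c e g : ℚ) • MonoidAlgebra.of ℚ G g)
  {u : ratCharIdempotents G → (b.pt ⟶ b.pt)} (hu : ∀ e, End.of (u e) = ∑ g, c e g • ρ g)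

omit [Fintype S] [Fintype G] in
/-- A 2-transitive action on a non-trivial finite set has exactly one orbit. [folklore] -/
private theorem natCard_orbitRel_quotient_eq_one_of_two [Finite S] (h2 : IsMultiplyPretransitive G S 2) :
    Nat.card (orbitRel.Quotient G S) = 1 := by
  haveI : IsMultiplyPretransitive G S 2 := h2
  haveI : IsPretransitive G S :=
    is_one_pretransitive_iff.1 (isMultiplyPretransitive_of_le (G := G) (α := S) one_le_two
      (Finite.one_lt_card_iff_nontrivial.2 ‹Nontrivial S›))
  rw [Nat.card_eq_one_iff_unique]
  refine ⟨⟨fun x y ↦ ?_⟩, ⟨Quotient.mk _ (Classical.arbitrary S)⟩⟩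
  induction x using Quotient.inductionOn with
  | h a =>
    induction y using Quotient.inductionOn with
    | h a' => exact Quotient.sound (MulAction.mem_orbit_iff.2 (MulAction.exists_smul_eq G a' a))

include hc hu

/-! ## §1 Any field: dimensions and `Hom`-counts of `B_θ`, `B_1`, and the vanishing of all other components -/

/-- **`dim B_θ(A^S) = (|S| − 1) · dim A`** for a 2-transitive `S`, `θ = π − 1` (any field).
[cite: JamesLiebeck2001, Cor. 29.10] [cite: LangeRodriguez2022, §2.9.1 Prop. 2.9.3 (PDF p. 46)] -/
theorem dim_isotypical_permAction_eq_of_isMultiplyPretransitive (h2 : IsMultiplyPretransitive G S 2)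
    (hb : ∑ s, b.π s ≫ b.ι s = 𝟙 b.pt) (hρ : ∀ (g : G) (s : S), b.ι s ≫ End.asHom (ρ g) = b.ι (g • s))
    (e : ratCharIdempotents G)
    (he : (e : MonoidAlgebra ℚ G) = ratCharIdempotent fun g : G ↦ (Nat.card (MulAction.fixedBy S g) : ℂ) - 1) :
    (image (u e)).dim = (Fintype.card S - 1) * A.dim := by
  rw [dim_isotypical_permAction_eq_finrank_mul b ρ hc hu hb hρ e, he,
    finrank_range_ofMulAction_ratCharIdempotent_sub_one h2]

/-- **`rk_ℤ Hom(B_θ(A^S), B) = (|S| − 1) · rk_ℤ Hom(A, B)`** for every `B` (2-transitive `S`, any field).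
[cite: JamesLiebeck2001, Cor. 29.10] [cite: LangeRodriguez2022, §2.9.1 Thm. 2.9.1 and Prop. 2.9.3 (PDF pp. 43, 46)] -/
theorem finrank_hom_isotypical_permAction_eq_of_isMultiplyPretransitive (h2 : IsMultiplyPretransitive G S 2)
    (B : AbelianVariety K) (hb : ∑ s, b.π s ≫ b.ι s = 𝟙 b.pt)
    (hρ : ∀ (g : G) (s : S), b.ι s ≫ End.asHom (ρ g) = b.ι (g • s)) (e : ratCharIdempotents G)
    (he : (e : MonoidAlgebra ℚ G) = ratCharIdempotent fun g : G ↦ (Nat.card (MulAction.fixedBy S g) : ℂ) - 1) :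
    Module.finrank ℤ (image (u e) ⟶ B) = (Fintype.card S - 1) * Module.finrank ℤ (A ⟶ B) := by
  rw [finrank_hom_isotypical_permAction_eq_finrank_mul b ρ hc hu B hb hρ e, he,
    finrank_range_ofMulAction_ratCharIdempotent_sub_one h2]

/-- **`dim B_1(A^S) = dim A`**: the trivial component (`= B_G`, the fixed part) of a permutation power over a 2-transitive —
in particular transitive — `S` (any field). [cite: JamesLiebeck2001, Prop. 29.4 and Cor. 29.10] [cite: SerreLinearRepresentations1977, §2.3 Ex. 2.6 (a)] -/
theorem dim_isotypical_one_permAction_eq_of_isMultiplyPretransitive (h2 : IsMultiplyPretransitive G S 2)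
    (hb : ∑ s, b.π s ≫ b.ι s = 𝟙 b.pt) (hρ : ∀ (g : G) (s : S), b.ι s ≫ End.asHom (ρ g) = b.ι (g • s))
    (e : ratCharIdempotents G) (he : (e : MonoidAlgebra ℚ G) = ratCharIdempotent (1 : G → ℂ)) :
    (image (u e)).dim = A.dim := by
  rw [dim_isotypical_permAction_eq_finrank_mul b ρ hc hu hb hρ e, he, finrank_range_ofMulAction_ratCharIdempotent_one,
    natCard_orbitRel_quotient_eq_one_of_two h2, one_mul]

/-- **`B_W(A^S) = 0` for every irreducible rational representation `W ∉ {1, θ}`** (2-transitive `S`, any field): `dim B_W(A^S) = 0`.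
[cite: JamesLiebeck2001, Cor. 29.10] [cite: LangeRodriguez2022, §2.9.1 Thm. 2.9.1 ("several of them might be zero") and Prop. 2.9.3 (ii) (PDF pp. 43, 46)] -/
theorem dim_isotypical_permAction_eq_zero_of_isMultiplyPretransitive (h2 : IsMultiplyPretransitive G S 2)
    (hb : ∑ s, b.π s ≫ b.ι s = 𝟙 b.pt) (hρ : ∀ (g : G) (s : S), b.ι s ≫ End.asHom (ρ g) = b.ι (g • s))
    (e : ratCharIdempotents G) (he₁ : (e : MonoidAlgebra ℚ G) ≠ ratCharIdempotent (1 : G → ℂ))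
    (heθ : (e : MonoidAlgebra ℚ G) ≠ ratCharIdempotent fun g : G ↦ (Nat.card (MulAction.fixedBy S g) : ℂ) - 1) :
    (image (u e)).dim = 0 := by
  obtain ⟨χ, hχ, hχe⟩ := mem_ratCharIdempotents_iff.1 e.2
  rw [dim_isotypical_permAction_eq_finrank_mul b ρ hc hu hb hρ e, ← hχe,
    finrank_range_ofMulAction_ratCharIdempotent_eq_zero h2 hχ (fun h ↦ he₁ (by rw [← hχe, h]))
      (fun h ↦ heθ (by rw [← hχe, h])), zero_mul]

/-- `rk_ℤ Hom(B_W(A^S), B) = 0` for `W ∉ {1, θ}` and every `B` (2-transitive `S`, any field).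
[cite: JamesLiebeck2001, Cor. 29.10] [cite: LangeRodriguez2022, §2.9.1 Thm. 2.9.1 (PDF p. 43)] -/
theorem finrank_hom_isotypical_permAction_eq_zero_of_isMultiplyPretransitive (h2 : IsMultiplyPretransitive G S 2)
    (B : AbelianVariety K) (hb : ∑ s, b.π s ≫ b.ι s = 𝟙 b.pt)
    (hρ : ∀ (g : G) (s : S), b.ι s ≫ End.asHom (ρ g) = b.ι (g • s)) (e : ratCharIdempotents G)
    (he₁ : (e : MonoidAlgebra ℚ G) ≠ ratCharIdempotent (1 : G → ℂ))
    (heθ : (e : MonoidAlgebra ℚ G) ≠ ratCharIdempotent fun g : G ↦ (Nat.card (MulAction.fixedBy S g) : ℂ) - 1) :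
    Module.finrank ℤ (image (u e) ⟶ B) = 0 := by
  obtain ⟨χ, hχ, hχe⟩ := mem_ratCharIdempotents_iff.1 e.2
  rw [finrank_hom_isotypical_permAction_eq_finrank_mul b ρ hc hu B hb hρ e, ← hχe,
    finrank_range_ofMulAction_ratCharIdempotent_eq_zero h2 hχ (fun h ↦ he₁ (by rw [← hχe, h]))
      (fun h ↦ heθ (by rw [← hχe, h])), zero_mul]

/-- **`rk Hom(A^S, B) = rk Hom(B_1(A^S), B) + rk Hom(B_θ(A^S), B)`** for every `B` (2-transitive `S`, any field): on
`Hom`-counts the power is exhausted by its two components `B_1`, `B_θ` (`|S| = 1 + (|S| − 1)`).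
[cite: JamesLiebeck2001, Cor. 29.10] [cite: LangeRodriguez2022, §2.9.1 Thm. 2.9.1 (b) (PDF p. 43)] -/
theorem finrank_hom_permPower_eq_add_of_isMultiplyPretransitive (h2 : IsMultiplyPretransitive G S 2)
    (B : AbelianVariety K) (hb : ∑ s, b.π s ≫ b.ι s = 𝟙 b.pt)
    (hρ : ∀ (g : G) (s : S), b.ι s ≫ End.asHom (ρ g) = b.ι (g • s)) (e₁ eθ : ratCharIdempotents G)
    (he₁ : (e₁ : MonoidAlgebra ℚ G) = ratCharIdempotent (1 : G → ℂ))
    (heθ : (eθ : MonoidAlgebra ℚ G) = ratCharIdempotent fun g : G ↦ (Nat.card (MulAction.fixedBy S g) : ℂ) - 1) :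
    Module.finrank ℤ (b.pt ⟶ B) = Module.finrank ℤ (image (u e₁) ⟶ B) + Module.finrank ℤ (image (u eθ) ⟶ B) := by
  rw [finrank_hom_permPower_eq B b hb, finrank_hom_isotypical_permAction_eq_finrank_mul b ρ hc hu B hb hρ e₁, he₁,
    finrank_range_ofMulAction_ratCharIdempotent_one, natCard_orbitRel_quotient_eq_one_of_two h2, one_mul,
    finrank_hom_isotypical_permAction_eq_of_isMultiplyPretransitive b ρ hc hu h2 B hb hρ eθ heθ]
  have hS : Fintype.card S = 1 + (Fintype.card S - 1) := (Nat.add_sub_cancel' Fintype.card_pos).symm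
  conv_lhs => rw [hS]
  rw [Nat.add_mul, one_mul]

/-! ## §2 Perfect field: `B_θ(A^S) ∼ A^{|S| − 1}`, `B_1(A^S) ∼ A`, `A^S ∼ B_1 × B_θ` -/

section Isogeny

variable [PerfectField K]

/-- **`B_θ(A^S) ∼ A^{|S| − 1} = ⨁_{Fin (|S| − 1)} A` for a 2-transitive `S`** (perfect field): the "standard part" of a doubly
transitive permutation power is one isotypical component, isogenous to `|S| − 1` copies of `A` (e.g. `(E^n)^{std} ∼ E^{n−1}` under
`𝔖_n`). [cite: JamesLiebeck2001, Cor. 29.10] [cite: LangeRodriguez2022, §2.9.1 Thm. 2.9.1 and Prop. 2.9.3 (PDF pp. 43, 46)]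
[cite: SerreLinearRepresentations1977, §2.3 Ex. 2.6 and §2.6 Thm. 8] -/
theorem isIsogenous_isotypical_permAction_biproduct_of_isMultiplyPretransitive (h2 : IsMultiplyPretransitive G S 2)
    (hb : ∑ s, b.π s ≫ b.ι s = 𝟙 b.pt) (hρ : ∀ (g : G) (s : S), b.ι s ≫ End.asHom (ρ g) = b.ι (g • s))
    (e : ratCharIdempotents G)
    (he : (e : MonoidAlgebra ℚ G) = ratCharIdempotent fun g : G ↦ (Nat.card (MulAction.fixedBy S g) : ℂ) - 1) :
    IsIsogenous (image (u e)) (⨁ fun _ : Fin (Fintype.card S - 1) ↦ A) := by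
  refine isIsogenous_iff_forall_finrank_hom_eq'.2 fun B ↦ ?_
  rw [finrank_hom_isotypical_permAction_eq_of_isMultiplyPretransitive b ρ hc hu h2 B hb hρ e he, finrank_hom_biproduct_const,
    Fintype.card_fin]

/-- **`B_1(A^S) ∼ A`** for a 2-transitive `S` (perfect field; the fixed part of a transitive permutation power is the diagonal).
[cite: JamesLiebeck2001, Prop. 29.4 and Cor. 29.10] [cite: SerreLinearRepresentations1977, §2.3 Ex. 2.6 (a)] -/
theorem isIsogenous_isotypical_one_permAction_of_isMultiplyPretransitive (h2 : IsMultiplyPretransitive G S 2)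
    (hb : ∑ s, b.π s ≫ b.ι s = 𝟙 b.pt) (hρ : ∀ (g : G) (s : S), b.ι s ≫ End.asHom (ρ g) = b.ι (g • s))
    (e : ratCharIdempotents G) (he : (e : MonoidAlgebra ℚ G) = ratCharIdempotent (1 : G → ℂ)) :
    IsIsogenous (image (u e)) A := by
  refine isIsogenous_iff_forall_finrank_hom_eq'.2 fun B ↦ ?_
  rw [finrank_hom_isotypical_permAction_eq_finrank_mul b ρ hc hu B hb hρ e, he, finrank_range_ofMulAction_ratCharIdempotent_one,
    natCard_orbitRel_quotient_eq_one_of_two h2, one_mul]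

/-- **`A^S ∼ B_1(A^S) × B_θ(A^S)`** for a 2-transitive `S` (perfect field): the isotypical decomposition of a doubly transitive
permutation power has exactly the two components of `1` and `θ` (all others vanish, §1).
[cite: JamesLiebeck2001, Cor. 29.10] [cite: LangeRodriguez2022, §2.9.1 Thm. 2.9.1 (b) (PDF p. 43)] [cite: SerreLinearRepresentations1977, §2.6 Thm. 8] -/
theorem isIsogenous_permPower_biprod_of_isMultiplyPretransitive (h2 : IsMultiplyPretransitive G S 2)
    (hb : ∑ s, b.π s ≫ b.ι s = 𝟙 b.pt) (hρ : ∀ (g : G) (s : S), b.ι s ≫ End.asHom (ρ g) = b.ι (g • s))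
    (e₁ eθ : ratCharIdempotents G) (he₁ : (e₁ : MonoidAlgebra ℚ G) = ratCharIdempotent (1 : G → ℂ))
    (heθ : (eθ : MonoidAlgebra ℚ G) = ratCharIdempotent fun g : G ↦ (Nat.card (MulAction.fixedBy S g) : ℂ) - 1) :
    IsIsogenous b.pt (image (u e₁) ⊞ image (u eθ)) := by
  refine isIsogenous_iff_forall_finrank_hom_eq'.2 fun B ↦ ?_
  rw [finrank_hom_biprod, finrank_hom_permPower_eq_add_of_isMultiplyPretransitive b ρ hc hu h2 B hb hρ e₁ eθ he₁ heθ]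

end Isogeny

end AbelianVariety

end Literature.AlgebraicGeometry.Motives
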